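import Literature.AlgebraicGeometry.Motives.HodgeStructure
import Literature.AlgebraicGeometry.Motives.HodgeTensor
import HarnessLib

-- provenance: harness21/H21/H21/Statements/Hodge/HodgeStructures.lean @ 7b3359d (interim HEAD d8f2665); M5 mechanical rewrite
/-!
# Hodge structures: the definition-statement **hodge.S09** (family `Hodge`)

The inventory item **hodge.S09** is a *definition*: "pure `ℚ`-Hodge structures of weight `k`,
Tate structures `ℚ(j)`, morphisms, polarisations, Hodge classes, Mumford–Tate group"
(Deligne, *Théorie de Hodge II*, Publ. IHÉS 40 (1971), §2.1; Voisin, *Hodge Theory and Complex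
Algebraic Geometry I*, §7.1). The definitions themselves are realised in the prelude
(`Literature.Prelude.MotiveAbstract.HodgeStructure`, item C5: `Literature.AlgebraicGeometry.Motives.HodgeStructure`, `piece`,
`hodgeNumber`, `hodgeClasses`, `level`, `Hom`, `tate`, `Polarization`, `IsPolarizable`;
`Literature.Prelude.MotiveAbstract.HodgeTensor`, item C6: `tateTwist`, `dual`, `tensor`, `hom`,
`hodgeGroup`, `mumfordTateGroup`). This file carries the statement id on a family of *sanity
theorems* about those definitions, mostly computed on the Tate structure `ℚ(j)`
(weight `-2j`, purely of type `(-j,-j)`; Deligne, Hodge II, 2.1.13):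

* `Hodge.hodgeNumber_tate`, `Hodge.hodgeNumber_tate_of_ne`: `h^{-j,-j}(ℚ(j)) = 1`, and
  `h^{p,q}(ℚ(j)) = 0` for every other `(p, q)`;
* `Hodge.hodgeClasses_tate`: every element of `ℚ(j)` is a Hodge class (of level `-j`);
* `Hodge.isPolarizable_tate`, `Hodge.level_tate`, `Hodge.piece_tateTwist`,
  `Hodge.level_tateTwist`;
* `Hodge.hodgeClasses_eq_comap_piece`: Hodge classes are the rational points of `V^{p,p}`;
* `Hodge.hom_strict`: morphisms are strict (Deligne, Hodge II, 2.3.5);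
* `Hodge.mem_mumfordTateGroup_iff`, `Hodge.mem_hodgeGroup_iff`: the tensor-stabiliser
  descriptions of `MT(H)` and `Hg(H)` (Deligne, LNM 900, I Prop. 3.4);
* `Hodge.hodgeGroup_tate`, `Hodge.mumfordTateGroup_tate`, `Hodge.mumfordTateGroup_tate_zero`:
  `Hg(ℚ(j)) = 1` for every `j`, `MT(ℚ(j))(ℚ) = ℚˣ` for `j ≠ 0`, and `MT(ℚ(0)) = 1`.

## Design notes

* Everything lives in `namespace Literature.Hodge`; no new definitions are introduced. The
  Mumford–Tate / Hodge group statements assume `[Module.Finite ℚ V]`, as the prelude (C6)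
  definitions `tensorSpace`, `hodgeGroup`, `mumfordTateGroup` do.
* The restatements `isPolarizable_tate`, `mem_mumfordTateGroup_iff`, `mem_hodgeGroup_iff`,
  `hodgeGroup_tate`, `mumfordTateGroup_tate(_zero)` deliberately reuse the short names of the
  prelude lemmas in `Literature.AlgebraicGeometry.Motives.HodgeStructure` (the outline fixes these names); a downstream file
  should open at most one of `Literature.Hodge`, `Literature.AlgebraicGeometry.Motives.HodgeStructure` to avoid ambiguity.
* Following the corrected prelude, `hodgeGroup_tate` needs no hypothesis on `j`, while
  `mumfordTateGroup_tate` needs `j ≠ 0` (in weight `0`, `MT = Hg = 1`).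
* The prelude's `piece p q` is `F^p ⊓ conj F^q` on the line `p + q = n` and `⊥` off it
  (Deligne, Hodge II, 1.2.5), so `hodgeNumber_tate_of_ne` holds for every `(p, q) ≠ (-j, -j)`
  without a hypothesis `p + q = -2j`.
* `hodgeClasses_eq_comap_piece` is stated in weight `n = p + p`, where it says that
  `hodgeClasses p` is the space of Hodge classes `V ∩ V^{p,p}` of Deligne, Hodge II, §2.1 /
  Voisin I, §11.3 (a rational vector in `F^p` is fixed by `conj`, hence lies in
  `F^p ⊓ conj F^p`).
* Proofs that are one-liners over the prelude's real constructions are given; the group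
  computations `hodgeGroup_tate`, `mumfordTateGroup_tate` and strictness (`hom_strict`) take the
  corresponding prelude named facts as explicit hypotheses `h` (D-0014).
* **Downstream note (M5 migration).** `mem_mumfordTateGroup_iff` / `mem_hodgeGroup_iff` now
  require the instance `[HodgeTensorFacts]` (class introduced upstream in `HodgeTensor`);
  the importer `EtaleTate.lean:493` applies `mem_mumfordTateGroup_iff` and needs the instance in
  scope. `hom_strict h f p`, `hodgeGroup_tate h j`, `mumfordTateGroup_tate h …`,
  `mumfordTateGroup_tate_zero h` take the prelude facts as `h`.
* Mathlib (pinned commit) has no Hodge structures, Mumford–Tate or Hodge groups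
  (`rg HodgeStructure|MumfordTate` finds nothing); we use `Module.finrank_top`,
  `LinearEquiv.finrank_eq`, `TensorProduct.AlgebraTensorModule.rid`, `csSup_le'`.
-/

open scoped TensorProduct

noncomputable section

namespace Literature.AlgebraicGeometry.Motives

section Hodge

open HodgeStructure

universe u v

variable {V : Type u} [AddCommGroup V] [Module ℚ V]
variable {W : Type v} [AddCommGroup W] [Module ℚ W]
variable {n : ℤ}

/-! ### The Tate structure `ℚ(j)` -/

/-- **hodge.S09** (Deligne, Hodge II, §2.1, 2.1.13; Voisin I, §7.1). The only Hodge piece of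
the Tate structure `ℚ(j)` is `V^{-j,-j} = ℂ`: as subspaces of `ℂ ⊗[ℚ] ℚ`,
`(tate j).piece (-j) (-j) = ⊤`. [folklore] -/
theorem piece_tate (j : ℤ) : (tate j).piece (-j) (-j) = ⊤ := by
  rw [piece_of_add_eq _ (by ring), tate_F, pureFiltration_of_le le_rfl, complexConj_top,
    top_inf_eq]

/-- **hodge.S09** (Deligne, Hodge II, §2.1, 2.1.13; Voisin I, §7.1.1). The Hodge number
`h^{-j,-j}` of the Tate structure `ℚ(j)` is `1`. [folklore] -/
theorem hodgeNumber_tate (j : ℤ) : (tate j).hodgeNumber (-j) (-j) = 1 := by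
  rw [hodgeNumber, piece_tate, finrank_top,
    (TensorProduct.AlgebraTensorModule.rid ℚ ℂ ℂ).finrank_eq, Module.finrank_self]

/-- **hodge.S09** (Deligne, Hodge II, §2.1, 2.1.13; Voisin I, §7.1.1). The Hodge pieces
`V^{p,q}` of `ℚ(j)` other than `V^{-j,-j}` vanish. [folklore] -/
theorem piece_tate_of_ne {j p q : ℤ} (h : ¬(p = -j ∧ q = -j)) : (tate j).piece p q = ⊥ := by
  by_cases hpq : p + q = -2 * j
  · rw [Submodule.eq_bot_iff]
    intro x hx
    by_contra hx0
    exact h (eq_of_mem_piece_tate hpq hx hx0)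
  · exact piece_eq_bot_of_add_ne _ hpq

/-- **hodge.S09** (Deligne, Hodge II, §2.1, 2.1.13; Voisin I, §7.1.1). The Hodge numbers
`h^{p,q}(ℚ(j))` vanish for `(p, q) ≠ (-j, -j)`: `ℚ(j)` is purely of type `(-j,-j)`. [folklore] -/
theorem hodgeNumber_tate_of_ne {j p q : ℤ} (h : ¬(p = -j ∧ q = -j)) :
    (tate j).hodgeNumber p q = 0 := by
  rw [hodgeNumber, piece_tate_of_ne h, finrank_bot]

/-- **hodge.S09** (Deligne, Hodge II, §2.1; Voisin I, §7.1 and §11.3). Every rational vector of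
`ℚ(j)` is a Hodge class (of filtration level `-j`, i.e. of type `(-j,-j)`):
`(tate j).hodgeClasses (-j) = ⊤`. [folklore] -/
theorem hodgeClasses_tate (j : ℤ) : (tate j).hodgeClasses (-j) = ⊤ := by
  rw [eq_top_iff]
  intro v _
  rw [mem_hodgeClasses_iff, tate_F, pureFiltration_of_le le_rfl]
  trivial

/-- **hodge.S09** (Deligne, Hodge II, 2.1.15; Voisin I, §7.1.2; Peters–Steenbrink, Ex. 2.10).
The Tate structure `ℚ(j)` is polarizable (by `Q(x, y) = xy`, untwisted sign convention; see
`Literature.AlgebraicGeometry.Motives.HodgeStructure.Polarization`). [folklore] -/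
theorem isPolarizable_tate (j : ℤ) : (tate j).IsPolarizable :=
  HodgeStructure.isPolarizable_tate j

/-- **hodge.S09** (Deligne, Hodge II, 2.1.13; Grothendieck 1969 for the level). The Tate
structure `ℚ(j)` has level `0`: its only nonzero Hodge piece is `V^{-j,-j}`. [cite: Grothendieck1969, for the level] -/
theorem level_tate (j : ℤ) : (tate j).level = 0 := by
  refine Nat.eq_zero_of_le_zero (csSup_le' ?_)
  rintro m ⟨p, q, hpq, hne, rfl⟩
  obtain ⟨x, hx, hx0⟩ := (Submodule.ne_bot_iff _).1 hne
  obtain ⟨rfl, rfl⟩ := eq_of_mem_piece_tate hpq hx hx0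
  simp

/-! ### Tate twists and Hodge classes -/

/-- **hodge.S09** (Deligne, Hodge II, 2.1.13–2.1.14; Peters–Steenbrink, Ex. 2.3). The Hodge
pieces of the Tate twist: `H(j)^{p,q} = H^{p+j,q+j}`. [folklore] -/
theorem piece_tateTwist (H : HodgeStructure V n) (j p q : ℤ) :
    (H.tateTwist j).piece p q = H.piece (p + j) (q + j) := by
  by_cases h : p + q = n - 2 * j
  · rw [piece_of_add_eq _ h, piece_of_add_eq _ (by omega), tateTwist_F, tateTwist_F]
  · rw [piece_eq_bot_of_add_ne _ h, piece_eq_bot_of_add_ne _ (by omega)]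

/-- **hodge.S09** (Deligne, Hodge II, 2.1.13–2.1.14; Grothendieck 1969 for the level). Tate
twisting does not change the level: the nonzero pieces of `H(j)` are those of `H` shifted by
`(j, j)`, and `|p - q|` is unchanged. [cite: Grothendieck1969, for the level] -/
theorem level_tateTwist (H : HodgeStructure V n) (j : ℤ) : (H.tateTwist j).level = H.level := by
  unfold HodgeStructure.level
  congr 1
  ext m
  constructor
  · rintro ⟨p, q, hpq, hne, rfl⟩
    exact ⟨p + j, q + j, by omega, (piece_tateTwist H j p q) ▸ hne, by congr 1; omega⟩
  · rintro ⟨p, q, hpq, hne, rfl⟩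
    refine ⟨p - j, q - j, by omega, ?_, by congr 1; omega⟩
    rw [piece_tateTwist]
    convert hne using 2 <;> omega

/-- **hodge.S09** (Deligne, Hodge II, §2.1; Voisin I, §7.1 and §11.3: Hodge classes). In
weight `n = 2p`, the rational classes of filtration level `p` are exactly the rational points
of `V^{p,p} = F^p ⊓ conj F^p`: `hodgeClasses p = ofRat ⁻¹' V^{p,p}`, the space of Hodge
classes `V ∩ V^{p,p}` (rational vectors are fixed by `conj`). [folklore] -/
theorem hodgeClasses_eq_comap_piece (H : HodgeStructure V n) {p : ℤ} (hn : p + p = n) :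
    H.hodgeClasses p = ((H.piece p p).restrictScalars ℚ).comap ofRat := by
  ext v
  refine ⟨fun hv => H.ofRat_mem_piece_of_mem_hodgeClasses hn hv, fun hv => ?_⟩
  exact (H.mem_hodgeClasses_iff p v).2 (H.piece_le_F p p hv)

/-! ### Morphisms -/

/-- **hodge.S09** (Deligne, Hodge II, Thm. 1.2.10 (iii) and 2.3.5; Voisin I, §7.3.1).
Morphisms of Hodge structures are strict for the Hodge filtration:
`f(F^p V₁) = F^p V₂ ∩ im f`.  One-line restatement of the prelude named fact
`HodgeStructure.Hom.strict` (G17), taken as the hypothesis `h`. [cite: DeligneHodgeII1971, Thm. 2.3.5] -/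
theorem hom_strict (h : Hom.strict (V := V) (W := W) (n := n))
    {H₁ : HodgeStructure V n} {H₂ : HodgeStructure W n} (f : Hom H₁ H₂) (p : ℤ) :
    (H₁.F p).map (f.toLinearMap.baseChange ℂ) =
      H₂.F p ⊓ LinearMap.range (f.toLinearMap.baseChange ℂ) :=
  h f p

/-! ### Mumford–Tate and Hodge groups -/

/-- **hodge.S09** (Deligne, *Hodge cycles on abelian varieties*, LNM 900, I Prop. 3.4; Moonen,
*An introduction to Mumford–Tate groups*, §4, Key Property 4.5). The Mumford–Tate group
(`ℚ`-points) of `H` is the subgroup of `GL(V)` fixing every rational tensor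
`t ∈ T^{a,b} V = V^{⊗a} ⊗ (V^∨)^{⊗b}` of weight `0` (`(a - b) n = 0`) and type `(0,0)`. [folklore] -/
theorem mem_mumfordTateGroup_iff [HodgeTensorFacts.{u, u}] [Module.Finite ℚ V] (H : HodgeStructure V n)
    (g : V ≃ₗ[ℚ] V) :
    g ∈ H.mumfordTateGroup ↔ ∀ a b : ℕ, ((a : ℤ) - b) * n = 0 →
      ∀ t ∈ (H.tensorSpace a b).hodgeClasses 0, tensorSpaceAct g t = t :=
  HodgeStructure.mem_mumfordTateGroup_iff H g

/-- **hodge.S09** (Deligne, LNM 900, I Prop. 3.4 and Rem. 3.5; Moonen, *An introduction to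
Mumford–Tate groups*, §4–§5). The Hodge group (`ℚ`-points) of `H` is the subgroup of `GL(V)`
fixing every Hodge tensor: every rational `t ∈ T^{a,b} V` of type `(p,p)`, `(a - b) n = 2p`. [folklore] -/
theorem mem_hodgeGroup_iff [HodgeTensorFacts.{u, u}] [Module.Finite ℚ V] (H : HodgeStructure V n)
    (g : V ≃ₗ[ℚ] V) :
    g ∈ H.hodgeGroup ↔ ∀ (a b : ℕ) (p : ℤ), ((a : ℤ) - b) * n = 2 * p →
      ∀ t ∈ (H.tensorSpace a b).hodgeClasses p, tensorSpaceAct g t = t :=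
  HodgeStructure.mem_hodgeGroup_iff H g

/-- **hodge.S09** (Moonen, *An introduction to Mumford–Tate groups*, §5, Example; Deligne,
LNM 900, I 3.4–3.5). The Hodge group of `ℚ(j)` is trivial: `T^{1,0} ℚ(j) = ℚ(j)` consists of
Hodge classes of type `(-j,-j)`, which every `g ≠ 1` moves. (The outline's hypothesis `j ≠ 0`
is not needed: for `j = 0` the type is `(0,0)` and the same argument applies.) Restatement of
the named fact `HodgeStructure.hodgeGroup_tate` of the prelude (hypothesis `h`). [folklore] -/
theorem hodgeGroup_tate [HodgeTensorFacts.{0, 0}] (h : HodgeStructure.hodgeGroup_tate) (j : ℤ) :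
    (tate j).hodgeGroup = ⊥ :=
  h j

/-- **hodge.S09** (Deligne, LNM 900, I 3.4: `MT(ℚ(1)) = 𝔾ₘ`; Moonen §4). For `j ≠ 0` the
Mumford–Tate group (`ℚ`-points) of `ℚ(j)` is all of `GL₁(ℚ) = ℚˣ`. The hypothesis `j ≠ 0` is
necessary: `MT(ℚ(0)) = Hg(ℚ(0)) = 1` (`mumfordTateGroup_tate_zero`). Restatement of the named
fact `HodgeStructure.mumfordTateGroup_tate` of the prelude (hypothesis `h`). [folklore] -/
theorem mumfordTateGroup_tate [HodgeTensorFacts.{0, 0}] (h : HodgeStructure.mumfordTateGroup_tate)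
    {j : ℤ} (hj : j ≠ 0) : (tate j).mumfordTateGroup = ⊤ :=
  h hj

/-- **hodge.S09** (Deligne, LNM 900, I 3.4; Moonen §4: `MT = Hg` in weight `0`). The
Mumford–Tate group of the unit object `ℚ(0)` is trivial (given the named fact
`HodgeStructure.hodgeGroup_tate`, hypothesis `h`). [folklore] -/
theorem mumfordTateGroup_tate_zero [HodgeTensorFacts.{0, 0}] (h : HodgeStructure.hodgeGroup_tate) :
    (tate 0).mumfordTateGroup = ⊥ :=
  HodgeStructure.mumfordTateGroup_tate_zero h

end Hodge

end Literature.AlgebraicGeometry.Motives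

end

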